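import Summits.BirchSwinnertonDyer.Rank1Residual.Additive.X4TamDefectMazurPrincipleNewVanishing
import HarnessLib

/-!
# TAM-DEFECT₂, the SCALAR case: the vanishing target at a split defect prime with SCALAR Frobenius, and the closure over BOTH targets (cell `b2b-bsdres`, seat additive-p4, line V46b)

HONEST FRAMING (verbatim, cell `b2b-bsdres`): the goal of the cell is to DELETE the COMBINATION-SHAPED
residual classes for ALL analytic-rank `≤ 1` curves over `ℚ` — "full BSD formula for every rank `≤ 1`
curve in class `C`" assembled STRICTLY from published theorems — so that the rank-`≤ 1` remainder
becomes exactly the CONSTRUCTION-SHAPED classes, which are TYPED (missing-input Props), NOT attempted;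
this is not "finishing BSD". This file: a research-route file of the CLASS-CLOSURE lane (class
N10/N11 TAM-DEFECT₂ residue): ONE MORE typed target (`@[conjecture] def`, asserting nothing) for the
sub-class SC that the Mazur-principle target EXCLUDES, a case split, and END theorems over the PAIR of
targets. Nothing booked; X4 stays CONSTRUCTION-SHAPED; no Literature fact.

## Why a second target, and why it is kept SEPARATE (different provenance, different grade)

`MazurPrincipleNewVanishing W p ℓ f` (V46) carries the binder "`ℓ ≢ 1 (mod p)` or `#W(ℚ_ℓ)[p] ≠ p²`"
(`ρ̄_{W,p}(Frob_ℓ)` NOT scalar): its provenance is Mazur's Frobenius argument (Ribet–Stein Thm. 3.14: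
`V = E'[p] ⊂ 𝒥⁰` by the Eisenstein component group, `λ(V) ⊂ T_{J/B_ℓ}[p]` where `Frob_ℓ = ℓ a_ℓ` is
scalar — contradiction), which says NOTHING when `Frob_ℓ` IS scalar (`ℓ ≡ 1 (mod p)` and
`E[p] ⊆ E(ℚ_ℓ)`). The SCALAR rows (census class SC: `p ≥ 5`: 26; `p = 3`: 25 TAM₂ rows, 19 of them in
the corner) need a different input. In print, for `p ∤ N` or (`p ∥ N`, `T_p ∉ 𝔪`), the same
conclusion `E'[p] ⊆ B_ℓ` follows from TWO published theorems: Ribet's level lowering in the scalar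
case (the "pivot" argument, Ribet–Stein Thm. 3.18; "without multiplicity one", Ribet–Stein §3.5 IV)
makes `𝔪` `ℓ`-old, so `B_ℓ[𝔪] ≠ 0`, and mod-`p` MULTIPLICITY ONE for `J₀(N)[𝔪]`
(Darmon–Diamond–Taylor Thm. 4.26 = Wiles 1995 Thm. 2.1) forces `E'[p] = J₀(N)[𝔪] = B_ℓ[𝔪]`. On the
cell's corner (`p² ∣ N`) multiplicity one is NOT in print — so here the target is GENUINELY OPEN, and is
typed separately so that its grade is not confused with the Mazur-principle target's. EVIDENCE (seat
instrument E5, GEN 27, kit `bsd-r1`): the vanishing HOLDS on every scalar row tested (17568a1, 17568d1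
(`ℓ = 61`), 21312bh1 (`ℓ = 37`) at `p = 3`, decided at level `N` alone), as gen 24's certificates did
(113904ba1, 130473o1, 497700bg1). EVIDENCE, never a fact.

* `MazurPrincipleNewVanishingScalar W p ℓ f` — the SAME vanishing conclusion as the V46 target,
  under the complementary binder `ℓ ≡ 1 (mod p) ∧ #W(ℚ_ℓ)[p] = p²`;
* `newVanishing_of_targets` — the two targets together give the vanishing at EVERY split `ℓ ∤ M`
  with `p ∣ c_ℓ` (case split); `plusSymbolLevelLowersAt_of_targets` — gen 20's certificate (via the
  V46 bridge: Ihara BY NAME + the numeral `q₀`);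
* ENDs `X4.bsdp_of_targets_of_tamagawa_le_two_of_shaAn_unit_of_{five_le, kim2025_OPEN}` — the whole
  split-defect part of TAM-DEFECT₂ (MP ∪ SC) closes modulo the TWO typed targets + published facts.

## References

* K. Ribet, W. Stein, *Lectures on Serre's conjectures*, §3.5 (I–IV), Thm. 3.14, Thm. 3.18. [cite: RibetStein2001, §3.5 (I–IV), Thm. 3.14, Thm. 3.18]
* H. Darmon, F. Diamond, R. Taylor, *Fermat's Last Theorem* (1995), Thm. 4.26 (p. 134). [cite: DarmonDiamondTaylor1995, Thm. 4.26 (p. 134)]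
* K. Ribet, Invent. Math. 100 (1990), Thm. 1.1, §6. [cite: Ribet1990, Thm. 1.1 and §6]
* K. A. Ribet, Proc. ICM 1983 (1984), Thm. 4.1. [cite: Ribet1984ICM, Thm. 4.1]
* C.-H. Kim, Amer. J. Math. 148 (2026), Thm. 1.9 (6), Conj. 1.10. [cite: Kim2022StructureSelmer, Thm. 1.9 (6) and Conj. 1.10 (PDF p. 8)]
-/

noncomputable section

open scoped MatrixGroups ModularForm Classical

open CongruenceSubgroup Finset

open Literature.NumberTheory.EllipticCurves Literature.NumberTheory.EllipticCurves.ModularForms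

namespace Summit.BirchSwinnertonDyer.Rank1Residual.LevelLowering

/-! ### §1 The typed target in the scalar case -/

section Target

variable (W : WeierstrassCurve ℚ) [W.IsGloballyMinimal] (p : ℕ) [Fact p.Prime]
  {M : ℕ} [NeZero M] (ℓ : ℕ) [Fact ℓ.Prime] (f : CuspForm (Gamma0 (M * ℓ)) 2)

/-- **THE VANISHING TARGET IN THE SCALAR CASE (typed target; V46b).** For `W/ℚ` globally minimal with
newform `f` at its conductor `N = Mℓ`, an odd prime `p` with `W[p]` irreducible, a prime `ℓ ≠ p`,
`ℓ ∤ M`, of SPLIT multiplicative reduction with `p ∣ c_ℓ(W)`, such that `ℓ ≡ 1 (mod p)` AND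
`#W(ℚ_ℓ)[p] = p²` (`ρ̄_{W,p}(Frob_ℓ)` is the identity — the SCALAR case EXCLUDED by
`MazurPrincipleNewVanishing`): the mod-`p` plus symbol of `f` VANISHES ON THE `ℓ`-NEW CYCLES of
`X₀(Mℓ)` (`[γ∞]⁺_f ≡ 0 (mod p)` whenever `α_*{∞, γ∞} = 0 = β_*{∞, γ∞}`), i.e. `E'[p] ⊆ B_ℓ` on the
real line. STATUS: OPEN on the corner. In print for `p ∤ N` (or `p ∥ N`, `T_p ∉ 𝔪`) as the
conjunction of Ribet's level lowering in the scalar case (Ribet–Stein §3.5 III/IV, Thm. 3.18; Ribet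
1990 Thm. 1.1) — `𝔪` is `ℓ`-old, `B_ℓ[𝔪] ≠ 0` — and mod-`p` multiplicity one for `J₀(N)[𝔪]`
(Darmon–Diamond–Taylor Thm. 4.26) — `E'[p] = J₀(N)[𝔪] ⊇ B_ℓ[𝔪]`; Mazur's Frobenius argument
(Ribet–Stein Thm. 3.14) gives nothing here. EVIDENCE: instrument E5 (GEN 27) decides the vanishing
per row at level `N`: HOLDS on 17568a1, 17568d1, 21312bh1 (`p = 3`, scalar `ℓ = 61, 61, 37`); gen 24
certificates HOLD on 113904ba1, 130473o1, 497700bg1. A TARGET; nothing asserted.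
[cite: RibetStein2001, §3.5 (I–IV), Thm. 3.14, Thm. 3.18] [cite: DarmonDiamondTaylor1995, Thm. 4.26 (p. 134)] -/
@[conjecture] def MazurPrincipleNewVanishingScalar : Prop :=
  IsNewformOf W f → W.conductorNorm ℤ = M * ℓ → p ≠ 2 → W.HasIrreducibleModPGaloisRep p →
    ℓ ≠ p → ¬ ℓ ∣ M → W.HasSplitMultiplicativeReductionAtPrime ℓ →
    p ∣ (W.baseChange ℚ_[ℓ]).localTamagawaNumber ℤ_[ℓ] →
    (ℓ ≡ 1 [MOD p] ∧
      Nat.card {P : (W.baseChange ℚ_[ℓ]).toAffine.Point // p • P = 0} = p ^ 2) →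
    ∀ γ : Gamma0 (M * ℓ), (γ : SL(2, ℤ)) 1 0 ≠ 0 →
      (degeneracyMap0 M (M * ℓ) 1 2).dualMap (periodFunctional (M * ℓ) γ) = 0 →
      (degeneracyMap0 M (M * ℓ) ℓ 2).dualMap (periodFunctional (M * ℓ) γ) = 0 →
        ((ratPlusSymbol f ((((γ : SL(2, ℤ)) 0 0 : ℤ) : ℚ) / (((γ : SL(2, ℤ)) 1 0 : ℤ) : ℚ)) : ℚ) :
            ZMod p) = 0

end Target

/-! ### §2 The case split: both targets ⟹ the vanishing at every split defect prime -/

section Bridge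

variable {W : WeierstrassCurve ℚ} [W.IsElliptic] [W.IsGloballyMinimal] {p : ℕ} [hp : Fact p.Prime]
  {M : ℕ} [NeZero M] {ℓ : ℕ} [hℓ : Fact ℓ.Prime] {f : CuspForm (Gamma0 (M * ℓ)) 2}

omit [W.IsElliptic] [W.IsGloballyMinimal] in
/-- **Scalar ∨ non-scalar.** The Mazur-principle target and the scalar-case target together give the
vanishing of `[·]⁺_f mod p` on the `ℓ`-new cycles at EVERY split multiplicative `ℓ ∤ M`, `ℓ ≠ p`,
with `p ∣ c_ℓ` (no Frobenius binder left). [folklore] -/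
theorem newVanishing_of_targets (hNV : MazurPrincipleNewVanishing W p ℓ f)
    (hSC : MazurPrincipleNewVanishingScalar W p ℓ f) (hf : IsNewformOf W f)
    (hN : W.conductorNorm ℤ = M * ℓ) (hp2 : p ≠ 2) (hirr : W.HasIrreducibleModPGaloisRep p)
    (hℓp : ℓ ≠ p) (hℓM : ¬ ℓ ∣ M) (hsplit : W.HasSplitMultiplicativeReductionAtPrime ℓ)
    (hcℓ : p ∣ (W.baseChange ℚ_[ℓ]).localTamagawaNumber ℤ_[ℓ]) :
    ∀ γ : Gamma0 (M * ℓ), (γ : SL(2, ℤ)) 1 0 ≠ 0 →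
      (degeneracyMap0 M (M * ℓ) 1 2).dualMap (periodFunctional (M * ℓ) γ) = 0 →
      (degeneracyMap0 M (M * ℓ) ℓ 2).dualMap (periodFunctional (M * ℓ) γ) = 0 →
        ((ratPlusSymbol f ((((γ : SL(2, ℤ)) 0 0 : ℤ) : ℚ) / (((γ : SL(2, ℤ)) 1 0 : ℤ) : ℚ)) : ℚ) :
            ZMod p) = 0 := by
  by_cases hs : (ℓ ≡ 1 [MOD p] ∧
      Nat.card {P : (W.baseChange ℚ_[ℓ]).toAffine.Point // p • P = 0} = p ^ 2)
  · exact hSC hf hN hp2 hirr hℓp hℓM hsplit hcℓ hs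
  · exact hNV hf hN hp2 hirr hℓp hℓM hsplit hcℓ (not_and_or.mp hs)

/-- **Gen 20's certificate at every split defect prime, from the two targets** (+ Ihara BY NAME + the
numeral `q₀`): the V46 bridge `plusSymbolLevelLowersAt_of_newVanishing` after the case split.
[cite: Ribet1984ICM, Thm. 4.1] [cite: RibetStein2001, Thm. 3.14, Thm. 3.18] -/
theorem plusSymbolLevelLowersAt_of_targets (hI : ribet1984_iharaLemma)
    (hNV : MazurPrincipleNewVanishing W p ℓ f) (hSC : MazurPrincipleNewVanishingScalar W p ℓ f)
    (hf : IsNewformOf W f) (hN : W.conductorNorm ℤ = M * ℓ) (hp2 : p ≠ 2)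
    (hirr : W.HasIrreducibleModPGaloisRep p) (hℓp : ℓ ≠ p) (hℓM : ¬ ℓ ∣ M)
    (hsplit : W.HasSplitMultiplicativeReductionAtPrime ℓ)
    (hcℓ : p ∣ (W.baseChange ℚ_[ℓ]).localTamagawaNumber ℤ_[ℓ])
    {q₀ : ℕ} (hq₀ : q₀.Prime) (hq₀1 : q₀ ≡ 1 [MOD M * ℓ])
    (haq₀ : ((W.LFunction q₀ : ℤ) : ZMod p) ≠ q₀ + 1) : PlusSymbolLevelLowersAt W p f ℓ :=
  plusSymbolLevelLowersAt_of_newVanishing hI hf hN hp2 hirr hℓM hsplit hq₀ hq₀1 haq₀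
    (newVanishing_of_targets hNV hSC hf hN hp2 hirr hℓp hℓM hsplit hcℓ)

end Bridge

end Summit.BirchSwinnertonDyer.Rank1Residual.LevelLowering

/-! ### §3 END: the split-defect part of TAM-DEFECT₂ (MP ∪ SC) closes modulo the TWO targets -/

namespace Summit.BirchSwinnertonDyer.Rank1Residual.X4

open Complex WeierstrassCurve Literature.NumberTheory.EllipticCurves.Rank1Residual
  Literature.NumberTheory.EllipticCurves.Rank1Residual.Typed
  Summit.BirchSwinnertonDyer.Rank1Residual.LevelLowering

variable (W : WeierstrassCurve ℚ) [W.IsElliptic] [W.IsGloballyMinimal] (p : ℕ) [Fact p.Prime]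

/-- **TAM-DEFECT₂ CLOSURE at `p ≥ 5` over BOTH vanishing targets** (MP ∪ SC: every unit TAM₂ row with
a split defect prime). `W/ℚ` globally minimal of analytic rank `0`, `p ≥ 5`, `ρ̄_{E,p}` onto, a
conductor-level datum `D` at level `Mℓ = N` with `p ∤ c_D` and the period transfer, `#Ш_an` a
`p`-unit, `ord_p ∏ c ≤ 2`, a split multiplicative `ℓ ∤ M`, `ℓ ≠ p`, with `p ∣ c_ℓ` (NO Frobenius
binder), a numeral prime `q₀ ≡ 1 (mod Mℓ)` with `a_{q₀} ≢ q₀ + 1 (mod p)`: IF the typed targets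
`MazurPrincipleNewVanishing W p ℓ D.f` and `MazurPrincipleNewVanishingScalar W p ℓ D.f` hold THEN
**`BSD(E,p)`** — from Ihara's lemma `ribet1984_iharaLemma` (BY NAME), Kim 2026 Thm. 1.8 (6),
Cassels–Tate, GZK, modularity (PUBLISHED), gen 20's certificate END. Nothing booked.
[cite: Kim2022StructureSelmer, Thm. 1.9 (6) and Conj. 1.10 (PDF p. 8)] [cite: RibetStein2001, Thm. 3.14, Thm. 3.18]
[cite: Ribet1984ICM, Thm. 4.1] [cite: SilvermanAEC2009, Thm. X.4.14] -/
theorem bsdp_of_targets_of_tamagawa_le_two_of_shaAn_unit_of_five_le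
    (hI : ribet1984_iharaLemma)
    (hKimk : Kim2026.rankZero_le_padicValNat_sha_of_kuriharaNumber_ne_zero)
    (hE67c : Kim2026.rankZero_padicValNat_sha_add_le_of_forall_pow_dvd_kuriharaNumber_cyclicLevel)
    (hCT : exists_casselsTate_pairing (K := ℚ))
    (hGZK : rank_eq_analyticRank_of_analyticRank_le_one) (hmod : hasEntireLFunction_rat)
    (hp : 5 ≤ p) (hr : W.analyticRank = 0) (hsurj : W.HasSurjectiveModNGaloisRep p)
    {M : ℕ} [NeZero M] {ℓ : ℕ} [Fact ℓ.Prime] [NeZero (M * ℓ)]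
    (D : ModularParametrizationData W (M * ℓ)) (hN : W.conductorNorm ℤ = M * ℓ)
    (hc : ¬ (p : ℤ) ∣ D.maninConstant)
    (hper : ∃ u : ℚ, ‖(u : ℚ_[p])‖ = 1 ∧ W.realPeriodRat = u * plusPeriod D.f)
    {q' : ℚ} (hq' : shaAn W = (q' : ℂ)) (hv : padicValRat p q' = 0)
    (hc2 : padicValNat p W.tamagawaProduct ≤ 2)
    (hℓp : ℓ ≠ p) (hℓM : ¬ ℓ ∣ M) (hsplit : W.HasSplitMultiplicativeReductionAtPrime ℓ)
    (hcℓ : p ∣ (W.baseChange ℚ_[ℓ]).localTamagawaNumber ℤ_[ℓ])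
    {q₀ : ℕ} (hq₀ : q₀.Prime) (hq₀1 : q₀ ≡ 1 [MOD M * ℓ])
    (haq₀ : ((W.LFunction q₀ : ℤ) : ZMod p) ≠ q₀ + 1)
    (hNV : MazurPrincipleNewVanishing W p ℓ D.f) (hSC : MazurPrincipleNewVanishingScalar W p ℓ D.f) :
    BSDp W p := by
  have hirr := hasIrreducibleModPGaloisRep_of_hasSurjectiveModNGaloisRep W p hsurj
  have hcert : PlusSymbolLevelLowersAt W p D.f ℓ :=
    plusSymbolLevelLowersAt_of_targets hI hNV hSC D.isNewformOf hN (by omega) hirr hℓp hℓM hsplit hcℓ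
      hq₀ hq₀1 haq₀
  have hℓN : ℓ ∣ W.conductorNorm ℤ := by rw [hN]; exact dvd_mul_left ℓ M
  exact bsdp_of_plusSymbolLevelLowersAt_of_tamagawa_le_two_of_shaAn_unit_of_five_le W p hKimk hE67c hCT
    hGZK hmod hp hr hsurj D hN hc hper hq' hv hcert hℓN hc2

/-- **The `p ≥ 3` tower twin over BOTH vanishing targets, CONDITIONAL on the announced Kim 2025
clause** (`hK25s`, flag `Kim2025-preprint`) — the N11 TAM-DEFECT₂(3) block, MP ∪ SC (the 19
SC∩corner rows included): analytic rank `0`, `ρ̄_{E,p^n}` onto for all `n`, conductor-level datum at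
level `Mℓ` with the period transfer, `#Ш_an` a `p`-unit, `ord_p ∏c ≤ 2`, a split multiplicative
`ℓ ∤ M`, `ℓ ≠ p`, with `p ∣ c_ℓ`, the numeral `q₀`, Ihara's lemma BY NAME, and the two typed targets
at `(W, p, ℓ, D.f)` ⟹ `BSD(E,p)`. [claim: Kim2025RefinedTNC, status: under-review]
[cite: Kim2025RefinedTNC, Thm. 1.1 ("BSD") (ANNOUNCED, OPEN binder)] [cite: RibetStein2001, Thm. 3.14, Thm. 3.18]
[cite: Ribet1984ICM, Thm. 4.1] [cite: Kim2022StructureSelmer, Conj. 1.10 (PDF p. 8)] -/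
theorem bsdp_of_targets_of_tamagawa_le_two_of_shaAn_unit_of_kim2025_OPEN
    (hI : ribet1984_iharaLemma)
    (hK25s : Kim2025.thm11_kimShaLength_of_integralPeriod_OPEN)
    (hCT : exists_casselsTate_pairing (K := ℚ))
    (hGZK : rank_eq_analyticRank_of_analyticRank_le_one) (hmod : hasEntireLFunction_rat)
    (hp3 : 3 ≤ p) (hr : W.analyticRank = 0) (htower : ∀ n : ℕ, W.HasSurjectiveModNGaloisRep (p ^ n : ℕ))
    {M : ℕ} [NeZero M] {ℓ : ℕ} [Fact ℓ.Prime] [NeZero (M * ℓ)]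
    (D : ModularParametrizationData W (M * ℓ)) (hN : W.conductorNorm ℤ = M * ℓ)
    (hper : ∃ u : ℚ, ‖(u : ℚ_[p])‖ = 1 ∧ W.realPeriodRat = u * plusPeriod D.f)
    {q' : ℚ} (hq' : shaAn W = (q' : ℂ)) (hv : padicValRat p q' = 0)
    (hc2 : padicValNat p W.tamagawaProduct ≤ 2)
    (hℓp : ℓ ≠ p) (hℓM : ¬ ℓ ∣ M) (hsplit : W.HasSplitMultiplicativeReductionAtPrime ℓ)
    (hcℓ : p ∣ (W.baseChange ℚ_[ℓ]).localTamagawaNumber ℤ_[ℓ])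
    {q₀ : ℕ} (hq₀ : q₀.Prime) (hq₀1 : q₀ ≡ 1 [MOD M * ℓ])
    (haq₀ : ((W.LFunction q₀ : ℤ) : ZMod p) ≠ q₀ + 1)
    (hNV : MazurPrincipleNewVanishing W p ℓ D.f) (hSC : MazurPrincipleNewVanishingScalar W p ℓ D.f) :
    BSDp W p := by
  have hsurj : W.HasSurjectiveModNGaloisRep p := by simpa using htower 1
  have hirr := hasIrreducibleModPGaloisRep_of_hasSurjectiveModNGaloisRep W p hsurj
  have hcert : PlusSymbolLevelLowersAt W p D.f ℓ :=
    plusSymbolLevelLowersAt_of_targets hI hNV hSC D.isNewformOf hN (by omega) hirr hℓp hℓM hsplit hcℓ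
      hq₀ hq₀1 haq₀
  have hℓN : ℓ ∣ W.conductorNorm ℤ := by rw [hN]; exact dvd_mul_left ℓ M
  exact bsdp_of_plusSymbolLevelLowersAt_of_tamagawa_le_two_of_shaAn_unit_of_kim2025_OPEN W p hK25s hCT
    hGZK hmod hp3 hr htower D hN hper hq' hv hcert hℓN hc2

/-- **RANK-ONE `p`-UNIT TAMAGAWA ROWS at `p ≥ 5`, Cassels–Tate-free, over BOTH vanishing targets** (MP ∪ SC;
V46b, rank-one twin of `bsdp_of_targets_of_tamagawa_le_two_of_shaAn_unit_of_five_le`). Analytic rank `1`,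
`p ≥ 5`, `ρ̄_{E,p}` onto and the tower, a conductor-level datum at `N = Mℓ₀` with `p ∤ c_D` and the
period transfer, a split `ℓ₀ ∤ M`, `ℓ₀ ≠ p`, with `p ∣ c_{ℓ₀}` (NO Frobenius binder), the numeral
`q₀`, ONE Kurihara number `δ̃_ℓ ≢ 0 (mod p²)` at a cyclic level-`2` Kolyvagin prime `ℓ`, `#Ш_an` a
`p`-unit; Ihara's lemma BY NAME; the two typed targets at `(W, p, ℓ₀, D.f)` ⟹ `BSD(E,p)` (Kim
Thm. 1.8 (3), GZK, modularity; gen 22's consumer `X4/KimDefectLevelLoweringRankOne`).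
[cite: Kim2022StructureSelmer, Thm. 1.8 (3); Thm. 1.9 (3)–(5) (PDF pp. 7–8)]
[cite: RibetStein2001, Thm. 3.14, Thm. 3.18] [cite: Ribet1984ICM, Thm. 4.1] -/
theorem bsdp_rankOne_of_targets_levelTwo_of_shaAn_unit_of_five_le
    (hI : ribet1984_iharaLemma)
    (hE73 : Kim2026.kuriharaPartial_vanishingOrder_eq_padicValNat_sha_add_partialInfty_of_maninConstant)
    (hGZK : rank_eq_analyticRank_of_analyticRank_le_one) (hmod : hasEntireLFunction_rat)
    (hp : 5 ≤ p) (hsurj : W.HasSurjectiveModNGaloisRep p)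
    (htower : ∀ n : ℕ, W.HasSurjectiveModNGaloisRep (p ^ n : ℕ)) (hr : W.analyticRank = 1)
    {M : ℕ} [NeZero M] {ℓ₀ : ℕ} [Fact ℓ₀.Prime] [NeZero (M * ℓ₀)]
    (D : ModularParametrizationData W (M * ℓ₀)) (hN : W.conductorNorm ℤ = M * ℓ₀)
    (hc : ¬ (p : ℤ) ∣ D.maninConstant)
    (hper : ∃ u : ℚ, ‖(u : ℚ_[p])‖ = 1 ∧ W.realPeriodRat = u * plusPeriod D.f)
    (hℓ₀p : ℓ₀ ≠ p) (hℓ₀M : ¬ ℓ₀ ∣ M) (hsplit : W.HasSplitMultiplicativeReductionAtPrime ℓ₀)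
    (hcℓ₀ : p ∣ (W.baseChange ℚ_[ℓ₀]).localTamagawaNumber ℤ_[ℓ₀])
    {q₀ : ℕ} (hq₀ : q₀.Prime) (hq₀1 : q₀ ≡ 1 [MOD M * ℓ₀])
    (haq₀ : ((W.LFunction q₀ : ℤ) : ZMod p) ≠ q₀ + 1)
    (hNV : MazurPrincipleNewVanishing W p ℓ₀ D.f) (hSC : MazurPrincipleNewVanishingScalar W p ℓ₀ D.f)
    (ℓ : ℕ) [Fact ℓ.Prime] (hℓ : Kato.IsKolyvaginPrime W p 2 ℓ)
    (hcyc : Nat.card {P : ((WeierstrassCurve.integralModelInt W).map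
        (Int.castRingHom (ZMod ℓ))).toAffine.Point // p • P = 0} ≤ p)
    (ψ : (ℓ' : ℕ) → (ZMod ℓ')ˣ →* Multiplicative (ZMod (p ^ 2)))
    (hψ : Function.Surjective (ψ ℓ)) (hδ : kuriharaNumber D.f (p ^ 2) ℓ ψ ≠ 0)
    {q : ℚ} (hq : shaAn W = (q : ℂ)) (hv : padicValRat p q = 0) : BSDp W p := by
  have hirr := hasIrreducibleModPGaloisRep_of_hasSurjectiveModNGaloisRep W p hsurj
  have hcert : PlusSymbolLevelLowersAt W p D.f ℓ₀ :=
    plusSymbolLevelLowersAt_of_targets hI hNV hSC D.isNewformOf hN (by omega) hirr hℓ₀p hℓ₀M hsplit hcℓ₀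
      hq₀ hq₀1 haq₀
  have hℓ₀N : ℓ₀ ∣ W.conductorNorm ℤ := by rw [hN]; exact dvd_mul_left ℓ₀ M
  exact bsdp_of_plusSymbolLevelLowersAt_levelTwo_rankOne_of_shaAn_unit_of_five_le W p hE73 hGZK hmod hp
    hsurj htower hr D hN hc hper hcert hℓ₀N ℓ hℓ hcyc ψ hψ hδ hq hv

/-- **RANK-ONE `ord_p ∏c = 2` ROWS at `p ≥ 5` with Cassels–Tate, over BOTH vanishing targets**: as
`bsdp_rankOne_of_targets_levelTwo_of_shaAn_unit_of_five_le` but with ONE Kurihara number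
`δ̃_ℓ ≢ 0 (mod p³)` at a cyclic level-`3` Kolyvagin prime and the Cassels–Tate pairing.
[cite: Kim2022StructureSelmer, Thm. 1.8 (3); Thm. 1.9 (3)–(5) (PDF pp. 7–8)]
[cite: RibetStein2001, Thm. 3.14, Thm. 3.18] [cite: Ribet1984ICM, Thm. 4.1] [cite: SilvermanAEC2009, Thm. X.4.14] -/
theorem bsdp_rankOne_of_targets_levelThree_of_casselsTate_of_shaAn_unit_of_five_le
    (hI : ribet1984_iharaLemma)
    (hE73 : Kim2026.kuriharaPartial_vanishingOrder_eq_padicValNat_sha_add_partialInfty_of_maninConstant)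
    (hCT : exists_casselsTate_pairing (K := ℚ))
    (hGZK : rank_eq_analyticRank_of_analyticRank_le_one) (hmod : hasEntireLFunction_rat)
    (hp : 5 ≤ p) (hsurj : W.HasSurjectiveModNGaloisRep p)
    (htower : ∀ n : ℕ, W.HasSurjectiveModNGaloisRep (p ^ n : ℕ)) (hr : W.analyticRank = 1)
    {M : ℕ} [NeZero M] {ℓ₀ : ℕ} [Fact ℓ₀.Prime] [NeZero (M * ℓ₀)]
    (D : ModularParametrizationData W (M * ℓ₀)) (hN : W.conductorNorm ℤ = M * ℓ₀)
    (hc : ¬ (p : ℤ) ∣ D.maninConstant)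
    (hper : ∃ u : ℚ, ‖(u : ℚ_[p])‖ = 1 ∧ W.realPeriodRat = u * plusPeriod D.f)
    (hℓ₀p : ℓ₀ ≠ p) (hℓ₀M : ¬ ℓ₀ ∣ M) (hsplit : W.HasSplitMultiplicativeReductionAtPrime ℓ₀)
    (hcℓ₀ : p ∣ (W.baseChange ℚ_[ℓ₀]).localTamagawaNumber ℤ_[ℓ₀])
    {q₀ : ℕ} (hq₀ : q₀.Prime) (hq₀1 : q₀ ≡ 1 [MOD M * ℓ₀])
    (haq₀ : ((W.LFunction q₀ : ℤ) : ZMod p) ≠ q₀ + 1)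
    (hNV : MazurPrincipleNewVanishing W p ℓ₀ D.f) (hSC : MazurPrincipleNewVanishingScalar W p ℓ₀ D.f)
    (ℓ : ℕ) [Fact ℓ.Prime] (hℓ : Kato.IsKolyvaginPrime W p 3 ℓ)
    (hcyc : Nat.card {P : ((WeierstrassCurve.integralModelInt W).map
        (Int.castRingHom (ZMod ℓ))).toAffine.Point // p • P = 0} ≤ p)
    (ψ : (ℓ' : ℕ) → (ZMod ℓ')ˣ →* Multiplicative (ZMod (p ^ 3)))
    (hψ : Function.Surjective (ψ ℓ)) (hδ : kuriharaNumber D.f (p ^ 3) ℓ ψ ≠ 0)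
    {q : ℚ} (hq : shaAn W = (q : ℂ)) (hv : padicValRat p q = 0) : BSDp W p := by
  have hirr := hasIrreducibleModPGaloisRep_of_hasSurjectiveModNGaloisRep W p hsurj
  have hcert : PlusSymbolLevelLowersAt W p D.f ℓ₀ :=
    plusSymbolLevelLowersAt_of_targets hI hNV hSC D.isNewformOf hN (by omega) hirr hℓ₀p hℓ₀M hsplit hcℓ₀
      hq₀ hq₀1 haq₀
  have hℓ₀N : ℓ₀ ∣ W.conductorNorm ℤ := by rw [hN]; exact dvd_mul_left ℓ₀ M
  exact bsdp_of_plusSymbolLevelLowersAt_levelThree_rankOne_of_casselsTate_of_shaAn_unit_of_five_le W p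
    hE73 hCT hGZK hmod hp hsurj htower hr D hN hc hper hcert hℓ₀N ℓ hℓ hcyc ψ hψ hδ hq hv

end Summit.BirchSwinnertonDyer.Rank1Residual.X4

end
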